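import Mathlib

/-!
# The resolvent-thread lemma behind the steady-continuation obstruction (finite-dimensional form)

Context (solo-blind programme, paper §21.5(v)(i)).  Linearising the planar steady Navier–Stokes
equations at a smooth forced carrier `ψ₀` and writing `η = Δφ`, the Jacobian factors as
`J_ν φ = Δ (𝔅 - ν) η` with ONE fixed compact operator `𝔅 = Δ⁻¹({ψ₀,·} + {Δ⁻¹·, ω₀})`; the
steady-bifurcation set is `σ_p(𝔅) ∩ (0,∞)` and the tangent of the fixed-force continuation is
`χ_ν = -ν Δ⁻¹ (𝔅 - ν)⁻¹ ω₀`.  Whether `χ_ν / ν` stays bounded along a thread `νₙ → 0` is then a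
statement about the resolvent of a single operator at a spectral parameter running into the
accumulation point `0` of its spectrum.  The two elementary facts that organise this question are
recorded here for a continuous linear map on a normed space (the Galerkin truncations `J_ν^{(K)}`
actually computed are finite-dimensional, where (1) applies verbatim):

1. `mem_range_of_resolvent_thread_bounded` — if `E` is finite-dimensional, `νₙ → 0`, `Rₙ` is a
   right inverse of `B - νₙ` and `‖Rₙ b‖` is bounded, then `b ∈ range B` (the inviscid tangent
   problem is solvable: condition (L1));
2. `resolvent_thread_apply_range` — if `b = B ζ` and `R` is a left inverse of `B - ν`, then
   `R b = ζ + ν • R ζ` exactly, so along the thread boundedness of `Rₙ b` is equivalent to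
   boundedness of `νₙ • Rₙ ζ` (the non-resonance condition (L2)), and `Rₙ b → ζ` iff
   `νₙ • Rₙ ζ → 0` (`resolvent_thread_tendsto_iff`).

In infinite dimension (1) needs `B` compact (weak subsequence + compactness); that version is not
formalised here.  Elementary; [folklore].
-/

open Filter Topology

namespace Summit.AnomalousDissipation.AnomalousDissipation.Theorems

namespace ResolventThread

variable {𝕜 : Type*} [RCLike 𝕜] {E : Type*} [NormedAddCommGroup E] [NormedSpace 𝕜 E]

/-- (L2-identity) If `b = B ζ` and `R` is a left inverse of `B - ν • 1`, then
`R b = ζ + ν • R ζ`. -/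
theorem resolvent_thread_apply_range (B R : E →L[𝕜] E) (ν : 𝕜) (ζ : E)
    (hR : ∀ x, R ((B - ν • (1 : E →L[𝕜] E)) x) = x) :
    R (B ζ) = ζ + ν • R ζ := by
  have h1 : B ζ = (B - ν • (1 : E →L[𝕜] E)) ζ + ν • ζ := by simp
  rw [h1, map_add, hR, map_smul]

/-- Along a thread: with `b = B ζ` and two-sided inverses `Rₙ` of `B - νₙ • 1`,
`Rₙ b → ζ` iff `νₙ • Rₙ ζ → 0`. -/
theorem resolvent_thread_tendsto_iff (B : E →L[𝕜] E) (ν : ℕ → 𝕜) (R : ℕ → (E →L[𝕜] E)) (ζ : E)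
    (hR : ∀ n x, R n ((B - ν n • (1 : E →L[𝕜] E)) x) = x) :
    Tendsto (fun n => R n (B ζ)) atTop (𝓝 ζ) ↔
      Tendsto (fun n => ν n • R n ζ) atTop (𝓝 0) := by
  have h : ∀ n, R n (B ζ) = ζ + ν n • R n ζ := fun n =>
    resolvent_thread_apply_range B (R n) (ν n) ζ (hR n)
  simp_rw [h]
  constructor
  · intro ht
    have := ht.sub_const ζ
    simpa using this
  · intro ht
    simpa using ht.const_add ζ

/-- (L1) Finite-dimensional resolvent-thread lemma: if `νₙ → 0`, `Rₙ` is a right inverse of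
`B - νₙ • 1` and `‖Rₙ b‖ ≤ M` for all `n`, then `b` lies in the range of `B`. -/
theorem mem_range_of_resolvent_thread_bounded [FiniteDimensional 𝕜 E] (B : E →L[𝕜] E) (b : E)
    (ν : ℕ → 𝕜) (R : ℕ → (E →L[𝕜] E)) (hν : Tendsto ν atTop (𝓝 0))
    (hR : ∀ n x, (B - ν n • (1 : E →L[𝕜] E)) (R n x) = x)
    (M : ℝ) (hM : ∀ n, ‖R n b‖ ≤ M) :
    b ∈ LinearMap.range (B : E →ₗ[𝕜] E) := by
  have hclosed : IsClosed (LinearMap.range (B : E →ₗ[𝕜] E) : Set E) :=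
    Submodule.closed_of_finiteDimensional _
  have hmem : ∀ n, B (R n b) ∈ (LinearMap.range (B : E →ₗ[𝕜] E) : Set E) :=
    fun n => ⟨R n b, rfl⟩
  have hid : ∀ n, B (R n b) = b + ν n • R n b := by
    intro n
    have h := hR n b
    have h1 : (B - ν n • (1 : E →L[𝕜] E)) (R n b) = B (R n b) - ν n • R n b := by simp
    rw [h1] at h
    exact eq_add_of_sub_eq h
  have hM0 : 0 ≤ M := le_trans (norm_nonneg _) (hM 0)
  have h0 : Tendsto (fun n => ν n • R n b) atTop (𝓝 0) := by
    have hg : Tendsto (fun n => ‖ν n‖ * M) atTop (𝓝 0) := by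
      have : Tendsto (fun n => ‖ν n‖ * M) atTop (𝓝 (‖(0 : 𝕜)‖ * M)) :=
        ((continuous_norm.tendsto 0).comp hν).mul_const M
      simpa using this
    refine squeeze_zero_norm (fun n => ?_) hg
    rw [norm_smul]
    exact mul_le_mul_of_nonneg_left (hM n) (norm_nonneg _)
  have htend : Tendsto (fun n => B (R n b)) atTop (𝓝 b) := by
    simp_rw [hid]
    simpa using (tendsto_const_nhds (x := b)).add h0
  exact hclosed.mem_of_tendsto htend (Eventually.of_forall hmem)

/-- The dichotomy packaged: under the hypotheses of (L1) with two-sided inverses, there is `ζ`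
with `B ζ = b` and the exact splitting `Rₙ b = ζ + νₙ • Rₙ ζ` for every `n`. -/
theorem resolvent_thread_dichotomy [FiniteDimensional 𝕜 E] (B : E →L[𝕜] E) (b : E)
    (ν : ℕ → 𝕜) (R : ℕ → (E →L[𝕜] E)) (hν : Tendsto ν atTop (𝓝 0))
    (hR : ∀ n x, (B - ν n • (1 : E →L[𝕜] E)) (R n x) = x)
    (hR' : ∀ n x, R n ((B - ν n • (1 : E →L[𝕜] E)) x) = x)
    (M : ℝ) (hM : ∀ n, ‖R n b‖ ≤ M) :
    ∃ ζ : E, B ζ = b ∧ ∀ n, R n b = ζ + ν n • R n ζ := by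
  obtain ⟨ζ, hζ⟩ := mem_range_of_resolvent_thread_bounded B b ν R hν hR M hM
  refine ⟨ζ, hζ, fun n => ?_⟩
  have := resolvent_thread_apply_range B (R n) (ν n) ζ (hR' n)
  rw [← this]
  exact congrArg (R n) hζ.symm

end ResolventThread

end Summit.AnomalousDissipation.AnomalousDissipation.Theorems
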